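import Mathlib
import Summits.MatrixMultiplication.MatrixMultiplication.Theses.FourierTwoFamiliesModP
import Summits.MatrixMultiplication.MatrixMultiplication.Theorems.PrimeTwoFamilies.Negative.Slices
import Literature.Computability.AlgebraicComplexity.SimultaneousDoubleProduct

/-!
# Line `Sketch` (capacity form), crux `PrimeTwoFamilies` (stmt-MatrixMultiplication-14308) — stub `stub_honestOfSelfConverse`

Self-converse gadgets contain honest designs: letters through a popular point, pushed through `π`.

Helper file landed `--supports stmt-MatrixMultiplication-14308`; the statement is the registered stub
signature verbatim (gadget / SDPP clauses inlined, no new definitions).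
-/

-- single-conjunct summit: the mandated namespace repeats `MatrixMultiplication`.
set_option linter.dupNamespace false

namespace Summit.MatrixMultiplication.MatrixMultiplication.Theorems.PrimeTwoFamilies.CapacityLift

open Finset
open Summit.MatrixMultiplication.MatrixMultiplication.Theses
open Summit.MatrixMultiplication.MatrixMultiplication.Theorems
open Summit.MatrixMultiplication.MatrixMultiplication.Theorems.PrimeTwoFamilies.Negative
open Literature.Computability.AlgebraicComplexity

/-- **Honest family through a common point** (engine): in a gadget of direct pairs `(P c, Q c)` with
the self-converse property for `π` (every ordered pair of distinct letters is strongly separated directly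
or after `π`), letters `e 0, …, e (n-1)` (distinct) that all contain the point `y` on their `Q`-side are
pairwise NON-separated (for `x ∈ P (e i)` the difference `y - x` is both a cross difference towards `e j`
and a diagonal difference of `e i`), hence their `π`-images are pairwise separated in BOTH directions, so
`(P ∘ π ∘ e, Q ∘ π ∘ e)` satisfies (W) ∧ (X) verbatim (an honest SDPP family) and `π ∘ e` is injective. -/
theorem honest_of_common_point {K : Type*} [AddCommGroup K] {r n : ℕ} (P Q : Fin r → Finset K)
    (hD : ∀ c : Fin r, ∀ x ∈ P c, ∀ x' ∈ P c, ∀ y ∈ Q c, ∀ y' ∈ Q c,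
      (x - x') + (y - y') = 0 → x = x' ∧ y = y')
    (hP : ∀ c, (P c).Nonempty) (hQ : ∀ c, (Q c).Nonempty) (π : Fin r → Fin r)
    (hπ : ∀ σ τ : Fin r, σ ≠ τ →
      (∀ x ∈ P σ, ∀ y ∈ Q τ, ∀ c : Fin r, ∀ x' ∈ P c, ∀ y' ∈ Q c, y - x ≠ y' - x') ∨
      (∀ x ∈ P (π σ), ∀ y ∈ Q (π τ), ∀ c : Fin r, ∀ x' ∈ P c, ∀ y' ∈ Q c, y - x ≠ y' - x'))
    (y : K) (e : Fin n → Fin r) (he : Function.Injective e) (hy : ∀ i, y ∈ Q (e i)) :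
    (∀ i : Fin n, ∀ a ∈ P (π (e i)), ∀ a' ∈ P (π (e i)), ∀ b ∈ Q (π (e i)), ∀ b' ∈ Q (π (e i)),
        (a - a') + (b - b') = 0 → a = a' ∧ b = b') ∧
    (∀ i j k : Fin n, ∀ a ∈ P (π (e i)), ∀ a' ∈ P (π (e j)), ∀ b ∈ Q (π (e j)), ∀ b' ∈ Q (π (e k)),
        (a - a') + (b - b') = 0 → i = k) ∧
    Function.Injective (π ∘ e) := by
  -- no two letters through `y` are separated
  have hns : ∀ i j : Fin n,
      ¬ (∀ x ∈ P (e i), ∀ y' ∈ Q (e j), ∀ c : Fin r, ∀ x' ∈ P c, ∀ y'' ∈ Q c, y' - x ≠ y'' - x') := by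
    intro i j hs
    obtain ⟨x, hx⟩ := hP (e i)
    exact hs x hx y (hy j) (e i) x hx y (hy i) rfl
  -- hence their images are separated, in both directions
  have hsep : ∀ i j : Fin n, i ≠ j →
      ∀ x ∈ P (π (e i)), ∀ y' ∈ Q (π (e j)), ∀ c : Fin r, ∀ x' ∈ P c, ∀ y'' ∈ Q c,
        y' - x ≠ y'' - x' := by
    intro i j hij
    rcases hπ (e i) (e j) (he.ne hij) with h | h
    · exact absurd h (hns i j)
    · exact h
  refine ⟨fun i => hD (π (e i)), ?_, ?_⟩
  · intro i j k a ha a' ha' b hb b' hb' h0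
    by_contra hik
    have e1 : b' - a = b - a' := by
      have h2 : (a - a') + (b - b') = (b - a') - (b' - a) := by abel
      rw [h2] at h0
      exact (sub_eq_zero.1 h0).symm
    exact hsep i k hik a ha b' hb' (π (e j)) a' ha' b hb e1
  · intro i j hij
    by_contra hne
    have hs := hsep i j hne
    simp only [Function.comp_apply] at hij
    rw [hij] at hs
    obtain ⟨x, hx⟩ := hP (π (e j))
    obtain ⟨z, hz⟩ := hQ (π (e j))
    exact hs x hx z hz (π (e j)) x hx z hz rfl

/-- **Honest family through a common point, `P`-side twin**: the same conclusion when the letters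
`e i` all contain the point `x` on their `P`-side (for `q ∈ Q (e j)` the difference `q - x` is a cross
difference towards `e j` and a diagonal difference of `e j`). -/
theorem honest_of_common_point_left {K : Type*} [AddCommGroup K] {r n : ℕ} (P Q : Fin r → Finset K)
    (hD : ∀ c : Fin r, ∀ x ∈ P c, ∀ x' ∈ P c, ∀ y ∈ Q c, ∀ y' ∈ Q c,
      (x - x') + (y - y') = 0 → x = x' ∧ y = y')
    (hP : ∀ c, (P c).Nonempty) (hQ : ∀ c, (Q c).Nonempty) (π : Fin r → Fin r)
    (hπ : ∀ σ τ : Fin r, σ ≠ τ →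
      (∀ x ∈ P σ, ∀ y ∈ Q τ, ∀ c : Fin r, ∀ x' ∈ P c, ∀ y' ∈ Q c, y - x ≠ y' - x') ∨
      (∀ x ∈ P (π σ), ∀ y ∈ Q (π τ), ∀ c : Fin r, ∀ x' ∈ P c, ∀ y' ∈ Q c, y - x ≠ y' - x'))
    (x : K) (e : Fin n → Fin r) (he : Function.Injective e) (hx : ∀ i, x ∈ P (e i)) :
    (∀ i : Fin n, ∀ a ∈ P (π (e i)), ∀ a' ∈ P (π (e i)), ∀ b ∈ Q (π (e i)), ∀ b' ∈ Q (π (e i)),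
        (a - a') + (b - b') = 0 → a = a' ∧ b = b') ∧
    (∀ i j k : Fin n, ∀ a ∈ P (π (e i)), ∀ a' ∈ P (π (e j)), ∀ b ∈ Q (π (e j)), ∀ b' ∈ Q (π (e k)),
        (a - a') + (b - b') = 0 → i = k) ∧
    Function.Injective (π ∘ e) := by
  -- no two letters through `x` are separated
  have hns : ∀ i j : Fin n,
      ¬ (∀ x' ∈ P (e i), ∀ y' ∈ Q (e j), ∀ c : Fin r, ∀ x'' ∈ P c, ∀ y'' ∈ Q c,
        y' - x' ≠ y'' - x'') := by
    intro i j hs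
    obtain ⟨q, hq⟩ := hQ (e j)
    exact hs x (hx i) q hq (e j) x (hx j) q hq rfl
  -- hence their images are separated, in both directions
  have hsep : ∀ i j : Fin n, i ≠ j →
      ∀ x' ∈ P (π (e i)), ∀ y' ∈ Q (π (e j)), ∀ c : Fin r, ∀ x'' ∈ P c, ∀ y'' ∈ Q c,
        y' - x' ≠ y'' - x'' := by
    intro i j hij
    rcases hπ (e i) (e j) (he.ne hij) with h | h
    · exact absurd h (hns i j)
    · exact h
  refine ⟨fun i => hD (π (e i)), ?_, ?_⟩
  · intro i j k a ha a' ha' b hb b' hb' h0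
    by_contra hik
    have e1 : b' - a = b - a' := by
      have h2 : (a - a') + (b - b') = (b - a') - (b' - a) := by abel
      rw [h2] at h0
      exact (sub_eq_zero.1 h0).symm
    exact hsep i k hik a ha b' hb' (π (e j)) a' ha' b hb e1
  · intro i j hij
    by_contra hne
    have hs := hsep i j hne
    simp only [Function.comp_apply] at hij
    rw [hij] at hs
    obtain ⟨x', hx'⟩ := hP (π (e j))
    obtain ⟨z, hz⟩ := hQ (π (e j))
    exact hs x' hx' z hz (π (e j)) x' hx' z hz rfl

/-- **Double counting**: the total size of a family of finsets over a finite type equals the sum over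
points of the number of members containing the point. -/
theorem honestOfSelfConverse_sum_card_eq {α : Type*} [Fintype α] [DecidableEq α] {r : ℕ}
    (Q : Fin r → Finset α) :
    ∑ c, (Q c).card = ∑ y : α, (univ.filter fun c : Fin r => y ∈ Q c).card := by
  have h1 : ∀ c : Fin r, (Q c).card = ∑ y : α, if y ∈ Q c then 1 else 0 := by
    intro c
    rw [Finset.sum_boole, Finset.filter_univ_mem]
    simp
  simp_rw [h1]
  rw [Finset.sum_comm]
  refine Finset.sum_congr rfl fun y _ => ?_
  rw [Finset.sum_boole]
  simp

/-- **A popular point**: some point of a finite nonempty type lies in at least the average number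
`(∑ c |Q c|) / |α|` of members of the family (real form: `∑ c |Q c| ≤ |α| · |{c : y ∈ Q c}|`). -/
theorem honestOfSelfConverse_exists_popular {α : Type*} [Fintype α] [DecidableEq α] [Nonempty α]
    {r : ℕ} (Q : Fin r → Finset α) :
    ∃ y : α, ((∑ c, (Q c).card : ℕ) : ℝ) ≤
      (Fintype.card α : ℝ) * ((univ.filter fun c : Fin r => y ∈ Q c).card : ℝ) := by
  obtain ⟨y, -, hy⟩ := Finset.exists_max_image (univ : Finset α)
    (fun y => (univ.filter fun c : Fin r => y ∈ Q c).card) univ_nonempty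
  refine ⟨y, ?_⟩
  rw [honestOfSelfConverse_sum_card_eq Q]
  have h : ∑ z : α, (univ.filter fun c : Fin r => z ∈ Q c).card ≤
      ∑ _z : α, (univ.filter fun c : Fin r => y ∈ Q c).card :=
    Finset.sum_le_sum fun z _ => hy z (mem_univ z)
  rw [Finset.sum_const, card_univ, smul_eq_mul] at h
  exact_mod_cast h

/-- **Threshold for the constant `2`**: for `m ≥ ⌈2^{4/ε}⌉₊` one has `2 ≤ m^{ε/4}`. -/
theorem honestOfSelfConverse_two_le_rpow {ε : ℝ} (hε : 0 < ε) {m : ℕ}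
    (hm : ⌈(2 : ℝ) ^ (4 / ε)⌉₊ ≤ m) : (2 : ℝ) ≤ (m : ℝ) ^ (ε / 4) := by
  have h2 : (2 : ℝ) ^ (4 / ε) ≤ (m : ℝ) := (Nat.le_ceil _).trans (by exact_mod_cast hm)
  have h3 : ((2 : ℝ) ^ (4 / ε)) ^ (ε / 4) ≤ (m : ℝ) ^ (ε / 4) :=
    Real.rpow_le_rpow (by positivity) h2 (by positivity)
  have h4 : ((2 : ℝ) ^ (4 / ε)) ^ (ε / 4) = 2 := by
    rw [← Real.rpow_mul (by norm_num : (0 : ℝ) ≤ 2)]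
    have : 4 / ε * (ε / 4) = 1 := by field_simp
    rw [this, Real.rpow_one]
  rw [h4] at h3
  exact h3

/-- **Self-converse gadgets contain honest designs** (registered stub `stub_honestOfSelfConverse` of line
`Sketch`, crux stmt-MatrixMultiplication-14308): if for every `ε > 0` there are arbitrarily large `m`, a
gadget of `r ≥ m^{1-ε}` direct pairs `(P c, Q c)` in `ℤ/m` of co-volume `|P c||Q c| ≥ m^{1-ε}`, and a map `π`
under which every ordered pair of distinct letters is strongly separated directly or after `π`, then for
every `ε > 0` there are arbitrarily large `m` and an HONEST SDPP family ((W) ∧ (X) verbatim) in `ℤ/m` with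
`n ≥ m^{1/2-ε}` pairs of co-volume `≥ m^{1-ε}` — in the same `ℤ/m`, with no lift and no transfer.
Proof: use the hypothesis at `ε/2` and `m ≥ max m₀ ⌈2^{4/ε}⌉₊`.  Each letter has a side of size
`≥ m^{(1-ε/2)/2}`, so `∑_c (|P c| + |Q c|) ≥ r·m^{(1-ε/2)/2} ≥ m^{(3/2)(1-ε/2)}`; the larger of the two sums
is `≥` half of that, and by double counting some point lies in `≥ m^{(3/2)(1-ε/2) - 1}/2 ≥ m^{1/2-ε}`
letters on that side (`2 ≤ m^{ε/4}`); these letters are pairwise non-separated, so their `π`-images form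
an honest family (`honest_of_common_point` / `_left`), injectively indexed, with the letters' co-volumes. -/
theorem stub_honestOfSelfConverse
    (h : ∀ ε : ℝ, 0 < ε → ∀ m₀ : ℕ, ∃ m ≥ m₀, ∃ r : ℕ, ∃ P Q : Fin r → Finset (ZMod m),
      ∃ π : Fin r → Fin r,
        (∀ c : Fin r, ∀ x ∈ P c, ∀ x' ∈ P c, ∀ y ∈ Q c, ∀ y' ∈ Q c,
            (x - x') + (y - y') = 0 → x = x' ∧ y = y') ∧
        (∀ σ τ : Fin r, σ ≠ τ →
            (∀ x ∈ P σ, ∀ y ∈ Q τ, ∀ c : Fin r, ∀ x' ∈ P c, ∀ y' ∈ Q c, y - x ≠ y' - x') ∨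
            (∀ x ∈ P (π σ), ∀ y ∈ Q (π τ), ∀ c : Fin r, ∀ x' ∈ P c, ∀ y' ∈ Q c, y - x ≠ y' - x')) ∧
        (m : ℝ) ^ (1 - ε) ≤ (r : ℝ) ∧
        ∀ c : Fin r, (m : ℝ) ^ (1 - ε) ≤ (((P c).card * (Q c).card : ℕ) : ℝ)) :
    ∀ ε : ℝ, 0 < ε → ∀ m₀ : ℕ, ∃ m ≥ m₀, ∃ n : ℕ, ∃ A B : Fin n → Finset (ZMod m),
      (∀ i : Fin n, ∀ a ∈ A i, ∀ a' ∈ A i, ∀ b ∈ B i, ∀ b' ∈ B i,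
          (a - a') + (b - b') = 0 → a = a' ∧ b = b') ∧
      (∀ i j k : Fin n, ∀ a ∈ A i, ∀ a' ∈ A j, ∀ b ∈ B j, ∀ b' ∈ B k,
          (a - a') + (b - b') = 0 → i = k) ∧
      (m : ℝ) ^ (1 / 2 - ε) ≤ (n : ℝ) ∧
      ∀ i : Fin n, (m : ℝ) ^ (1 - ε) ≤ (((A i).card * (B i).card : ℕ) : ℝ) := by
  intro ε hε m₀
  have hε2 : 0 < ε / 2 := by linarith
  obtain ⟨m, hm, r, P, Q, π, hD, hπ, hr, hcov⟩ := h (ε / 2) hε2 (max (max m₀ 1) ⌈(2 : ℝ) ^ (4 / ε)⌉₊)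
  have hm₀ : m₀ ≤ m := le_trans (le_trans (le_max_left _ _) (le_max_left _ _)) hm
  have hm1 : 1 ≤ m := le_trans (le_trans (le_max_right _ _) (le_max_left _ _)) hm
  have hmc : ⌈(2 : ℝ) ^ (4 / ε)⌉₊ ≤ m := le_trans (le_max_right _ _) hm
  haveI : NeZero m := ⟨by omega⟩
  have hm1' : (1 : ℝ) ≤ m := by exact_mod_cast hm1
  have hm0' : (0 : ℝ) < m := by linarith
  have htwo : (2 : ℝ) ≤ (m : ℝ) ^ (ε / 4) := honestOfSelfConverse_two_le_rpow hε hmc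
  -- every letter is nonempty on both sides
  have hpos : ∀ c, 0 < (P c).card * (Q c).card := by
    intro c
    have h1 : (0 : ℝ) < (m : ℝ) ^ (1 - ε / 2) := Real.rpow_pos_of_pos hm0' _
    have h2 := lt_of_lt_of_le h1 (hcov c)
    exact_mod_cast h2
  have hPne : ∀ c, (P c).Nonempty := fun c =>
    Finset.card_pos.1 (Nat.pos_of_mul_pos_right (hpos c))
  have hQne : ∀ c, (Q c).Nonempty := fun c =>
    Finset.card_pos.1 (Nat.pos_of_mul_pos_left (hpos c))
  -- side sizes: |P c| + |Q c| ≥ t := m^{(1-ε/2)/2}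
  set t : ℝ := (m : ℝ) ^ ((1 - ε / 2) / 2) with ht
  have ht0 : 0 < t := Real.rpow_pos_of_pos hm0' _
  have htt : t * t = (m : ℝ) ^ (1 - ε / 2) := by
    rw [ht, ← Real.rpow_add hm0']
    ring_nf
  have hside : ∀ c, t ≤ ((P c).card : ℝ) + ((Q c).card : ℝ) := by
    intro c
    by_contra hlt
    push Not at hlt
    have ha : ((P c).card : ℝ) < t := by
      have : (0 : ℝ) ≤ ((Q c).card : ℝ) := Nat.cast_nonneg _
      linarith
    have hb : ((Q c).card : ℝ) < t := by
      have : (0 : ℝ) ≤ ((P c).card : ℝ) := Nat.cast_nonneg _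
      linarith
    have hab : ((P c).card : ℝ) * ((Q c).card : ℝ) < t * t :=
      mul_lt_mul'' ha hb (Nat.cast_nonneg _) (Nat.cast_nonneg _)
    rw [htt] at hab
    have := hcov c
    push_cast at this
    linarith
  -- total: ∑ (|P c| + |Q c|) ≥ r t ≥ m^{1-ε/2} t = m^{3(1-ε/2)/2}
  have hsum : (m : ℝ) ^ (1 - ε / 2) * t ≤
      (∑ c, ((P c).card : ℝ)) + ∑ c, ((Q c).card : ℝ) := by
    rw [← Finset.sum_add_distrib]
    calc (m : ℝ) ^ (1 - ε / 2) * t ≤ (r : ℝ) * t :=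
          mul_le_mul_of_nonneg_right hr ht0.le
      _ = ∑ _c : Fin r, t := by rw [Finset.sum_const, card_univ, Fintype.card_fin, nsmul_eq_mul]
      _ ≤ ∑ c, (((P c).card : ℝ) + ((Q c).card : ℝ)) := Finset.sum_le_sum fun c _ => hside c
  have hkey : (m : ℝ) ^ (1 - ε / 2) * t = (m : ℝ) * ((m : ℝ) ^ (1 / 2 - ε) * (m : ℝ) ^ (ε / 4)) := by
    rw [ht]
    calc (m : ℝ) ^ (1 - ε / 2) * (m : ℝ) ^ ((1 - ε / 2) / 2)
        = (m : ℝ) ^ ((1 - ε / 2) + (1 - ε / 2) / 2) := (Real.rpow_add hm0' _ _).symm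
      _ = (m : ℝ) ^ ((1 : ℝ) + ((1 / 2 - ε) + ε / 4)) := by congr 1; ring
      _ = (m : ℝ) ^ (1 : ℝ) * ((m : ℝ) ^ (1 / 2 - ε) * (m : ℝ) ^ (ε / 4)) := by
          rw [Real.rpow_add hm0', Real.rpow_add hm0']
      _ = (m : ℝ) * ((m : ℝ) ^ (1 / 2 - ε) * (m : ℝ) ^ (ε / 4)) := by rw [Real.rpow_one]
  -- from a popular point on the big side to the honest family
  have main : ∀ (S : Fin r → Finset (ZMod m)),
      (m : ℝ) ^ (1 - ε / 2) * t ≤ 2 * ∑ c, ((S c).card : ℝ) →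
      (∀ (y : ZMod m) (n : ℕ) (e : Fin n → Fin r), Function.Injective e → (∀ i, y ∈ S (e i)) →
        (∀ i : Fin n, ∀ a ∈ P (π (e i)), ∀ a' ∈ P (π (e i)), ∀ b ∈ Q (π (e i)), ∀ b' ∈ Q (π (e i)),
            (a - a') + (b - b') = 0 → a = a' ∧ b = b') ∧
        (∀ i j k : Fin n, ∀ a ∈ P (π (e i)), ∀ a' ∈ P (π (e j)), ∀ b ∈ Q (π (e j)),
            ∀ b' ∈ Q (π (e k)), (a - a') + (b - b') = 0 → i = k)) →
      ∃ n : ℕ, ∃ A B : Fin n → Finset (ZMod m),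
        (∀ i : Fin n, ∀ a ∈ A i, ∀ a' ∈ A i, ∀ b ∈ B i, ∀ b' ∈ B i,
            (a - a') + (b - b') = 0 → a = a' ∧ b = b') ∧
        (∀ i j k : Fin n, ∀ a ∈ A i, ∀ a' ∈ A j, ∀ b ∈ B j, ∀ b' ∈ B k,
            (a - a') + (b - b') = 0 → i = k) ∧
        (m : ℝ) ^ (1 / 2 - ε) ≤ (n : ℝ) ∧
        ∀ i : Fin n, (m : ℝ) ^ (1 - ε) ≤ (((A i).card * (B i).card : ℕ) : ℝ) := by
    intro S hS hhon
    obtain ⟨y, hy⟩ := honestOfSelfConverse_exists_popular S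
    rw [ZMod.card] at hy
    set T : Finset (Fin r) := univ.filter fun c : Fin r => y ∈ S c with hT
    set n : ℕ := T.card with hn
    let e : Fin n → Fin r := fun i => ((T.equivFin.symm i : T) : Fin r)
    have he : Function.Injective e :=
      Subtype.val_injective.comp T.equivFin.symm.injective
    have hye : ∀ i, y ∈ S (e i) := by
      intro i
      have hmem : (e i) ∈ T := (T.equivFin.symm i).2
      rw [hT, Finset.mem_filter] at hmem
      exact hmem.2
    obtain ⟨hW, hX⟩ := hhon y n e he hye
    refine ⟨n, fun i => P (π (e i)), fun i => Q (π (e i)), hW, hX, ?_, fun i => ?_⟩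
    · -- m^{1/2-ε} ≤ n: from m · n ≥ ∑|S c| ≥ m^{1-ε/2} t / 2 = m · m^{1/2-ε} · m^{ε/4} / 2
      have h1 : (m : ℝ) * ((m : ℝ) ^ (1 / 2 - ε) * (m : ℝ) ^ (ε / 4)) ≤ 2 * ((m : ℝ) * (n : ℝ)) := by
        rw [← hkey]
        refine hS.trans ?_
        have : (∑ c, ((S c).card : ℝ)) ≤ (m : ℝ) * (n : ℝ) := by
          have := hy
          push_cast at this ⊢
          rw [hn]
          exact this
        linarith
      have h2 : (m : ℝ) ^ (1 / 2 - ε) * (m : ℝ) ^ (ε / 4) ≤ 2 * (n : ℝ) := by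
        have h3 : (m : ℝ) * ((m : ℝ) ^ (1 / 2 - ε) * (m : ℝ) ^ (ε / 4)) ≤ (m : ℝ) * (2 * (n : ℝ)) := by
          linarith
        exact le_of_mul_le_mul_left h3 hm0'
      have h4 : (0 : ℝ) ≤ (m : ℝ) ^ (1 / 2 - ε) := (Real.rpow_pos_of_pos hm0' _).le
      nlinarith
    · calc (m : ℝ) ^ (1 - ε) ≤ (m : ℝ) ^ (1 - ε / 2) :=
            Real.rpow_le_rpow_of_exponent_le hm1' (by linarith)
        _ ≤ _ := hcov (π (e i))
  -- which side is big?
  have hsum2 : (m : ℝ) ^ (1 - ε / 2) * t ≤ 2 * ∑ c, ((P c).card : ℝ) ∨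
      (m : ℝ) ^ (1 - ε / 2) * t ≤ 2 * ∑ c, ((Q c).card : ℝ) := by
    by_cases hc : (∑ c, ((P c).card : ℝ)) ≤ ∑ c, ((Q c).card : ℝ)
    · right; linarith
    · left; push Not at hc; linarith
  rcases hsum2 with hbig | hbig
  · obtain ⟨n, A, B, hW, hX, hnb, hcv⟩ := main P hbig fun x n e he hx =>
      let H := honest_of_common_point_left P Q hD hPne hQne π hπ x e he hx
      ⟨H.1, H.2.1⟩
    exact ⟨m, hm₀, n, A, B, hW, hX, hnb, hcv⟩
  · obtain ⟨n, A, B, hW, hX, hnb, hcv⟩ := main Q hbig fun y n e he hy =>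
      let H := honest_of_common_point P Q hD hPne hQne π hπ y e he hy
      ⟨H.1, H.2.1⟩
    exact ⟨m, hm₀, n, A, B, hW, hX, hnb, hcv⟩

end Summit.MatrixMultiplication.MatrixMultiplication.Theorems.PrimeTwoFamilies.CapacityLift
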